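import Summits.NavierStokesRegularity.NavierStokesRegularity.Cruxes.BoundedTemperatureClosed.StrategistChecks
import Summits.NavierStokesRegularity.NavierStokesRegularity.Theorems.PumpContinuationMildBlowupClassical

/-!
# Crux `BoundedTemperatureClosed` (stmt-NavierStokesRegularity-18303) — redirect strategist r1:
# summit placement of the two leaves (kernel-checked companion of STRATEGY-CENSUS.md rev 3)

Second-opinion strategist seat (`cstrat-…-r1`, 2026-08-17). All sorry-free. With the proved bridge
`MildBlowupClassical` (`pumpContinuation_mildBlowupClassical_proof`) and the exact split
`BoundedTemperatureClosed ↔ NSTypeICeilingClosed ∧ OffCollinearClosed` (`boundedTemperatureClosed_iff_subs`,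
p1's `StrategistChecks`), the crux sits against the summit `NavierStokesRegularity` (Clay (A)) as follows:

* `not_navierStokesRegularity_of_nsTypeI` — ONE Schwartz-data `H¹⁰_df`-mild Type-I blow-up of
  Navier–Stokes at any ceiling already refutes Clay (A) (the Type-I rate is not even needed);
* `nsTypeICeilingClosed_of_navierStokesRegularity` — hence Clay (A) proves the NS leaf
  (`= ¬ TypeIInfimumNotAttainedNS`) VACUOUSLY: the leaf is a consequence of the positive summit, so it can
  never be refuted short of a Millennium counterexample, and
  `boundedTemperatureClosed_iff_offCollinear_of_navierStokesRegularity` — on the Clay side the crux IS its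
  off-collinear leaf;
* `not_eulerProximatePump_of_noTypeI_of_boundedTemperatureClosed` — on the Type-I-exclusion branch
  (`𝒯 = ∅`, the only known METHOD toward the NS leaf) the crux REFUTES its sister crux, the Door
  `EulerProximatePump`: proving the Link that way dooms the route;
* `exists_coldest_of_door_of_boundedTemperatureClosed` — on the other branch the route's own conjunction
  `Door ∧ Link` manufactures a COLDEST Schwartz-data Type-I blow-up of Navier–Stokes (the infimal Type-I
  temperature is attained), and `boundedTemperatureClosed_iff_coldest_and_offCollinear_of_door` — relative
  to the Door the crux is EXACTLY "NS has a coldest Schwartz-data mild Type-I blow-up" ∧ Leaf B.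

So every honest line for the crux must either exclude Type-I blow-up for Schwartz-data mild NS (open since
Leray; kills the Door) or produce a coldest NS blow-up (contains a Clay (A) counterexample plus a sharp
temperature floor): this is the theorem-level content of the `no-strategy` verdict (STRATEGY-CENSUS.md §0, §5).

## References

* T. Tao, J. Amer. Math. Soc. 29 (2016), arXiv:1402.0290v3, §1.1 (1.13), (1.15). [`Tao2016AveragedNS`]
* W. Rusin, V. Šverák, J. Funct. Anal. 260 (2011), arXiv:0911.0500, §1 question (Q). [`RusinSverak2011`]
* H. Koch, N. Nadirashvili, G. Seregin, V. Šverák, Acta Math. 203 (2009), §1. [`KochNadirashviliSereginSverak2009`]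
-/

noncomputable section

-- the nested summit namespace `…NavierStokesRegularity.NavierStokesRegularity…` is the tree's layout (D-0017)
set_option linter.dupNamespace false

namespace Summit.NavierStokesRegularity.NavierStokesRegularity.Cruxes.BoundedTemperatureClosed.StrategistR1

open MeasureTheory Set Filter Topology
open scoped ENNReal
open Literature.Analysis.FluidPDE Literature.Analysis.FluidPDE.Tao2016
open Summit.NavierStokesRegularity.NavierStokesRegularity.Theses.PumpContinuation
open Summit.NavierStokesRegularity.NavierStokesRegularity.Theorems
open Summit.NavierStokesRegularity.NavierStokesRegularity.Theorems.BoundedTemperatureClosed.Negative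
open Summit.NavierStokesRegularity.NavierStokesRegularity.Theorems.PumpContinuationBoundedTemperatureClosedSplit

/-- **Navier–Stokes has a Schwartz-data `H¹⁰_df`-mild Type-I blow-up at ceiling `M`** (membership of the
crux's set at the Euler end `θ = 1`; verbatim the negative lane's `nsTypeI[M]`). -/
local notation3 "nsTypeI[" M "]" =>
  ∃ u₀ : SchwartzMap (EuclideanSpace ℝ (Fin 3)) (EuclideanSpace ℝ (Fin 3)),
    Literature.Analysis.FluidPDE.VectorCalculus.IsDivFree ⇑u₀ ∧ ∃ S : ℝ, 0 < S ∧
    ∃ u : ℝ → Literature.Analysis.FluidPDE.Tao2016.L2C,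
      Literature.Analysis.FluidPDE.Tao2016.IsMildSolutionFor
        Literature.Analysis.FluidPDE.Tao2016.eulerForm
        (Literature.Analysis.FluidPDE.Tao2016.schwartzL2 u₀) (Set.Ico 0 S) u ∧
      (∀ t ∈ Set.Ico 0 S, MeasureTheory.eLpNorm (u t) ⊤ MeasureTheory.volume ≤
        ENNReal.ofReal (M / Real.sqrt (S - t))) ∧
      ¬ ∃ S' : ℝ, S < S' ∧ ∃ v : ℝ → Literature.Analysis.FluidPDE.Tao2016.L2C,
        Literature.Analysis.FluidPDE.Tao2016.IsMildSolutionFor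
          Literature.Analysis.FluidPDE.Tao2016.eulerForm
          (Literature.Analysis.FluidPDE.Tao2016.schwartzL2 u₀) (Set.Ico 0 S') v ∧
        ∀ t ∈ Set.Ico 0 S, v t = u t

/-- **NS has a coldest Schwartz-data mild Type-I blow-up**: the Type-I ceiling set `𝒯 = {K | nsTypeI[K]}`
has a least element (the infimal Type-I temperature is positive and ATTAINED by a Schwartz datum). OPEN both
ways — it contains a Schwartz-data blow-up of Navier–Stokes (so it refutes Clay (A),
`not_navierStokesRegularity_of_coldestNS`) AND the attainment of the infimal temperature (Rusin–Šverák's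
question (Q) for Schwartz data); users take `(h : ColdestNS)` as an explicit hypothesis. [status: open]
[topic Analysis/FluidPDE] [cite: RusinSverak2011, §1 question (Q)] -/
@[conjecture] def ColdestNS : Prop :=
  ∃ K : ℝ, 0 < K ∧ nsTypeI[K] ∧ ∀ K' : ℝ, nsTypeI[K'] → K ≤ K'

/-! ### The Clay side: one Schwartz-data mild Type-I blow-up refutes the summit -/

/-- **A single Schwartz-data `H¹⁰_df`-mild blow-up of Navier–Stokes with a Type-I rate refutes Clay (A).**
The proved bridge `MildBlowupClassical` upgrades the mild non-continuable trajectory to a maximal smooth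
Leray–Hopf solution with rapidly decaying datum, and `blowup_assembly` with the proved Clay uniqueness
`blowup_clay_uniqueness` contradicts `NavierStokesRegularity`; the rate is discarded.
[cite: Tao2016AveragedNS, §1.1 (1.5), (1.15)] -/
theorem not_navierStokesRegularity_of_nsTypeI {K : ℝ} (h : nsTypeI[K]) : ¬ NavierStokesRegularity := by
  obtain ⟨u₀, hdiv, S, hS, u, hmild, -, hnoext⟩ := h
  obtain ⟨T, hT, w, p, hmax, hLH, hdec⟩ :=
    pumpContinuation_mildBlowupClassical_proof u₀ hdiv S hS u hmild hnoext
  exact Literature.NS.blowup_assembly ⟨⟨1, one_pos, T, hT, w, p, hmax, hLH, hdec⟩, blowup_clay_uniqueness⟩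

/-- **Clay (A) empties the Type-I ceiling set**: `NavierStokesRegularity → ∀ K, ¬ nsTypeI[K]`. [folklore] -/
theorem not_nsTypeI_of_navierStokesRegularity (hA : NavierStokesRegularity) (K : ℝ) : ¬ nsTypeI[K] :=
  fun h => not_navierStokesRegularity_of_nsTypeI h hA

/-- **Clay (A) proves the NS leaf (vacuously).** `NSTypeICeilingClosed` (`= ¬ TypeIInfimumNotAttainedNS`)
is a CONSEQUENCE of the positive summit: the hypothesis "every `K' > K` is an admissible ceiling" is absurd
under (A). So the leaf is irrefutable short of a counterexample to (A). [folklore] -/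
theorem nsTypeICeilingClosed_of_navierStokesRegularity (hA : NavierStokesRegularity) :
    NSTypeICeilingClosed :=
  fun K _ hall => absurd (hall (K + 1) (by linarith)) (not_nsTypeI_of_navierStokesRegularity hA _)

/-- Equivalently, Clay (A) refutes the registered open hypothesis `H = TypeIInfimumNotAttainedNS` of the
negative lane (so the disprover's conditional kill `H → ¬crux` can only ever fire together with `¬(A)`). [folklore] -/
theorem not_typeIInfimumNotAttainedNS_of_navierStokesRegularity (hA : NavierStokesRegularity) :
    ¬ TypeIInfimumNotAttainedNS :=
  nsTypeICeilingClosed_iff_not_typeIInfimumNotAttainedNS.1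
    (nsTypeICeilingClosed_of_navierStokesRegularity hA)

/-- **On the Clay side the crux is exactly its off-collinear leaf**:
`NavierStokesRegularity → (BoundedTemperatureClosed ↔ OffCollinearClosed)`. [folklore] -/
theorem boundedTemperatureClosed_iff_offCollinear_of_navierStokesRegularity (hA : NavierStokesRegularity) :
    BoundedTemperatureClosed ↔ OffCollinearClosed :=
  ⟨offCollinearClosed_of_boundedTemperatureClosed,
    boundedTemperatureClosed_of_subs (nsTypeICeilingClosed_of_navierStokesRegularity hA)⟩

/-! ### The Type-I-exclusion branch kills the Door -/

/-- **If Navier–Stokes has NO Schwartz-data mild Type-I blow-up (`𝒯 = ∅`), the crux refutes the Door.**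
Closedness at the Door's datum puts the endpoint `θ = 1` into the set
(`endpointLinkTypeI_of_boundedTemperatureClosed`), i.e. produces `nsTypeI[M]`
(`nsTypeI_of_endpointLinkTypeI_of_door`). So the one known method toward the NS leaf — Type-I exclusion —
turns the Link into a disproof of its sister crux `EulerProximatePump`. [cite: KochNadirashviliSereginSverak2009, §1] -/
theorem not_eulerProximatePump_of_noTypeI_of_boundedTemperatureClosed (hno : ∀ K : ℝ, ¬ nsTypeI[K])
    (hC : BoundedTemperatureClosed) : ¬ EulerProximatePump := by
  intro hD
  obtain ⟨M, hM⟩ :=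
    nsTypeI_of_endpointLinkTypeI_of_door (endpointLinkTypeI_of_boundedTemperatureClosed hC) hD
  exact hno M hM

/-- In particular (A) ∧ Link ⟹ ¬Door — the contrapositive reading of `closes` with the bridge discharged. [folklore] -/
theorem not_eulerProximatePump_of_navierStokesRegularity_of_boundedTemperatureClosed
    (hA : NavierStokesRegularity) (hC : BoundedTemperatureClosed) : ¬ EulerProximatePump :=
  not_eulerProximatePump_of_noTypeI_of_boundedTemperatureClosed (not_nsTypeI_of_navierStokesRegularity hA) hC

/-! ### The attainment branch: `Door ∧ Link` manufactures a coldest NS blow-up -/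

/-- **The route's conjunction produces a COLDEST Schwartz-data mild Type-I blow-up of Navier–Stokes.**
The Door plus closedness makes `𝒯` non-empty (endpoint bite); the NS leaf of the crux plus Leray's floor
`exists_typeIFloor` makes `𝒯` closed and bounded below by a positive constant (`isClosed_ceilingSet`), so
`inf 𝒯 ∈ 𝒯` (`IsClosed.csInf_mem`). [cite: KochNadirashviliSereginSverak2009, §1] -/
theorem exists_coldest_of_door_of_boundedTemperatureClosed (hD : EulerProximatePump)
    (hC : BoundedTemperatureClosed) : ColdestNS := by
  obtain ⟨M, hM⟩ :=
    nsTypeI_of_endpointLinkTypeI_of_door (endpointLinkTypeI_of_boundedTemperatureClosed hC) hD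
  have hcl : IsClosed {K : ℝ | nsTypeI[K]} :=
    isClosed_ceilingSet (nsTypeICeilingClosed_of_boundedTemperatureClosed hC)
  obtain ⟨c, hc, hfloor⟩ := exists_typeIFloor
  have hne : ({K : ℝ | nsTypeI[K]} : Set ℝ).Nonempty := ⟨M, hM⟩
  have hbdd : BddBelow ({K : ℝ | nsTypeI[K]} : Set ℝ) := ⟨c, fun K hK => hfloor K hK⟩
  refine ⟨sInf {K : ℝ | nsTypeI[K]}, ?_, hcl.csInf_mem hne hbdd, fun K' hK' => csInf_le hbdd hK'⟩
  exact lt_of_lt_of_le hc (le_csInf hne fun K hK => hfloor K hK)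

/-- A coldest blow-up gives the NS leaf back: if `K₀ = min 𝒯` exists then a ceiling `K` all of whose strict
upper ceilings are admissible has `K₀ ≤ K`, hence is admissible by monotonicity (`nsTypeI_mono`). [folklore] -/
theorem nsTypeICeilingClosed_of_coldestNS (h : ColdestNS) : NSTypeICeilingClosed := by
  obtain ⟨K₀, -, hK₀, hmin⟩ := h
  intro K _ hall
  have hle : K₀ ≤ K := le_of_forall_gt_imp_ge_of_dense fun K' hK' => hmin K' (hall K' hK')
  exact nsTypeI_mono hle hK₀

/-- **Relative to its sister crux, the Link is EXACTLY "coldest NS blow-up ∧ off-collinear closedness"**: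
`EulerProximatePump → (BoundedTemperatureClosed ↔ ColdestNS ∧ OffCollinearClosed)`. Any proof of the crux
that keeps the route alive therefore CONTAINS a Schwartz-data Type-I blow-up of Navier–Stokes attaining the
infimal Type-I temperature. [cite: RusinSverak2011, §1 question (Q)] -/
theorem boundedTemperatureClosed_iff_coldest_and_offCollinear_of_door (hD : EulerProximatePump) :
    BoundedTemperatureClosed ↔ ColdestNS ∧ OffCollinearClosed :=
  ⟨fun hC => ⟨exists_coldest_of_door_of_boundedTemperatureClosed hD hC,
      offCollinearClosed_of_boundedTemperatureClosed hC⟩,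
    fun h => boundedTemperatureClosed_of_subs (nsTypeICeilingClosed_of_coldestNS h.1) h.2⟩

/-- **The dichotomy every line must resolve** (summary): the NS leaf of the crux holds iff the Type-I ceiling
set is empty or has a least element — Type-I exclusion (which refutes the Door,
`not_eulerProximatePump_of_noTypeI_of_boundedTemperatureClosed`) or a coldest blow-up (which refutes Clay (A),
`not_navierStokesRegularity_of_nsTypeI`). [cite: RusinSverak2011, §1 question (Q)] -/
theorem nsTypeICeilingClosed_iff_empty_or_coldest :
    NSTypeICeilingClosed ↔ (∀ K : ℝ, ¬ nsTypeI[K]) ∨ ColdestNS := by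
  constructor
  · intro hA
    by_cases hne : ∃ M : ℝ, nsTypeI[M]
    · right
      obtain ⟨M, hM⟩ := hne
      have hcl : IsClosed {K : ℝ | nsTypeI[K]} := isClosed_ceilingSet hA
      obtain ⟨c, hc, hfloor⟩ := exists_typeIFloor
      have hne' : ({K : ℝ | nsTypeI[K]} : Set ℝ).Nonempty := ⟨M, hM⟩
      have hbdd : BddBelow ({K : ℝ | nsTypeI[K]} : Set ℝ) := ⟨c, fun K hK => hfloor K hK⟩
      refine ⟨sInf {K : ℝ | nsTypeI[K]}, ?_, hcl.csInf_mem hne' hbdd, fun K' hK' => csInf_le hbdd hK'⟩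
      exact lt_of_lt_of_le hc (le_csInf hne' fun K hK => hfloor K hK)
    · left
      exact fun K hK => hne ⟨K, hK⟩
  · rintro (hno | hcold)
    · exact fun K _ hall => absurd (hall (K + 1) (by linarith)) (hno _)
    · exact nsTypeICeilingClosed_of_coldestNS hcold

/-- Both horns are summit-grade: the coldest horn refutes Clay (A). [folklore] -/
theorem not_navierStokesRegularity_of_coldestNS (h : ColdestNS) : ¬ NavierStokesRegularity := by
  obtain ⟨K, -, hK, -⟩ := h
  exact not_navierStokesRegularity_of_nsTypeI hK

end Summit.NavierStokesRegularity.NavierStokesRegularity.Cruxes.BoundedTemperatureClosed.StrategistR1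

end
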